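import Literature.NumberTheory.Sieve.Maynard2016ZetaNormalised

/-!
# Maynard (2016), Lemma 6: the `ζ`-side product at two scales, `(φ(W)/W · log b)^k Z = M · ∏ R_j` ((6.17)–(6.18))

Trunk: AntSieve / parity (Maynard 2016 large-gaps ladder, named fact
`Literature.NumberTheory.Sieve.Maynard2016.Lemma6MainTerm` of `Maynard2016Lemma6Split.lean`).

J. Maynard, *Large gaps between primes*, Ann. of Math. 183 (2016) = arXiv:1408.5110, §6, proof of
Lemma 6, displays (6.17)–(6.18): in the cube `|ξ|, |τ| ≤ √log x`, using `ζ(1+z) = (1+o(1))/z`,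
"`∏_ℓ ζ_W(1+(2+iξ+iξ')/log x)/(ζ_W(1+(1+iξ)/log x) ζ_W(1+(1+iξ')/log x)) = (1+o(1)) (W/φ(W))^k (log x)^{-k}
∏_ℓ (1+iξ_ℓ)(1+iξ'_ℓ)/(2+iξ_ℓ+iξ'_ℓ)`", and the same at the scale `log y` for the `τ`-variables.
This is the two-scale, general-modulus version of the tree's Polymath 8b (kt)-algebra
(`LcmEuler.pow_mul_zetaLimit_eq`, hard-wired to `W = polymathW x` and the scale `log x`):
* `LcmEuler.zetaRatioW W L q` — the correction factor `R = 𝒩_W((s+s')/L)/(𝒩_W(s/L) 𝒩_W(s'/L))`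
  built from the normalised zeta value `𝒩_W` of `Maynard2016ZetaNormalised`;
* `LcmEuler.pow_mul_zetaLimit_eq_pairModel` — the exact identity
  `(φ(W)/W · log b)^k · Z_W(a(ξ), b(ξ')) = M(ξ,ξ') · ∏_j R_j` at the scale `b > 1`
  (`a_j = s(ξ_j)/log b`, `M = pairModel`);
* `Maynard2016.eventually_norm_prod_zetaRatioW_sub_one_le` — for `W = P_w` and any scale `b` with
  `log y ≤ log b`: eventually in `x`, on the cube `InCube √(log x)`, every `𝒩` in sight is non-zero and
  `‖∏_j R_j − 1‖ ≤ η` ((6.18): "`= (1 + o(1)) …`").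

## References

* J. Maynard, *Large gaps between primes*, Ann. of Math. (2) 183 (2016), 915–933; arXiv:1408.5110,
  §6, proof of Lemma 6, displays (6.17)–(6.18). [Maynard2016LargeGaps]
* D. H. J. Polymath, *Variants of the Selberg sieve, and bounded intervals containing many primes*,
  Res. Math. Sci. 1 (2014), Art. 12; arXiv:1407.4897, proof of Lemma 4.1, (kt), p. 13. [Polymath8b2014]
-/

noncomputable section

open Filter Finset Real
open scoped BigOperators Topology

namespace Literature.NumberTheory.Sieve

namespace LcmEuler

variable {ι : Type*} [Fintype ι]

/-! ### The correction factors and the exact identity -/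

/-- `R_W(L; ξ, ξ') := 𝒩_W((s(ξ)+s(ξ'))/L) / (𝒩_W(s(ξ)/L) 𝒩_W(s(ξ')/L))`. [cite: Maynard2016LargeGaps, §6 display (6.18)] -/
def zetaRatioW (W : ℕ) (L : ℝ) (q : ℝ × ℝ) : ℂ :=
  zetaWN W ((sOf q.1 + sOf q.2) / (L : ℂ)) / (zetaWN W (sOf q.1 / (L : ℂ)) * zetaWN W (sOf q.2 / (L : ℂ)))

omit [Fintype ι] in
/-- `s(ξ) + s(ξ') ≠ 0` (real part `2`). [folklore] -/
private theorem sOf_add_sOf_ne_zero (a b : ℝ) : sOf a + sOf b ≠ 0 := fun h => by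
  have := congrArg Complex.re h
  norm_num [sOf_re] at this

/-- **`(φ(W)/W · log b)^k · Z = M · ∏_j R_j`** at the scale `b > 1`: with `a_j = s(ξ_j)/log b`,
`b_j = s(ξ'_j)/log b`, `Z = ∏_j ζ_W(1+a_j+b_j)/(ζ_W(1+a_j) ζ_W(1+b_j))` (`zetaLimit`) and
`M = ∏_j s(ξ_j)s(ξ'_j)/(s(ξ_j)+s(ξ'_j))` (`pairModel`), provided the normalised values `𝒩_W(a_j)`,
`𝒩_W(b_j)` are non-zero. [cite: Maynard2016LargeGaps, §6 displays (6.17)–(6.18)] -/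
theorem pow_mul_zetaLimit_eq_pairModel {W : ℕ} (hW : W ≠ 0) {b : ℝ} (hb : 1 < b) (p : ι → ℝ × ℝ)
    (hN : ∀ j, zetaWN W (sOf (p j).1 / (Real.log b : ℂ)) ≠ 0 ∧
      zetaWN W (sOf (p j).2 / (Real.log b : ℂ)) ≠ 0) :
    ((((Nat.totient W : ℝ) / W * Real.log b : ℝ)) : ℂ) ^ Fintype.card ι *
        zetaLimit W (expA b p) (expB b p) =
      pairModel p * ∏ j, zetaRatioW W (Real.log b) (p j) := by
  have hL : (Real.log b : ℂ) ≠ 0 := by exact_mod_cast (Real.log_pos hb).ne'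
  have hφ : ((((Nat.totient W : ℝ) / W : ℝ)) : ℂ) ≠ 0 := by
    have h1 : (0 : ℝ) < Nat.totient W := Nat.cast_pos.2 (Nat.totient_pos.2 (Nat.pos_of_ne_zero hW))
    have h2 : (0 : ℝ) < W := Nat.cast_pos.2 (Nat.pos_of_ne_zero hW)
    exact_mod_cast (div_pos h1 h2).ne'
  rw [zetaLimit, pairModel, ← Finset.prod_mul_distrib, ← Finset.card_univ, ← Finset.prod_const,
    ← Finset.prod_mul_distrib]
  refine Finset.prod_congr rfl fun j _ => ?_
  have hs1 := sOf_ne_zero (p j).1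
  have hs2 := sOf_ne_zero (p j).2
  have hs12 := sOf_add_sOf_ne_zero (p j).1 (p j).2
  have hu1 : sOf (p j).1 / (Real.log b : ℂ) ≠ 0 := div_ne_zero hs1 hL
  have hu2 : sOf (p j).2 / (Real.log b : ℂ) ≠ 0 := div_ne_zero hs2 hL
  have hu12 : (sOf (p j).1 + sOf (p j).2) / (Real.log b : ℂ) ≠ 0 := div_ne_zero hs12 hL
  have e3 : (1 : ℂ) + expA b p j + expB b p j = 1 + (sOf (p j).1 + sOf (p j).2) / (Real.log b : ℂ) := by
    simp only [expA, expB]; ring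
  rw [e3, zetaW_eq_zetaWN hW hu12,
    show (1 : ℂ) + expA b p j = 1 + sOf (p j).1 / (Real.log b : ℂ) from rfl, zetaW_eq_zetaWN hW hu1,
    show (1 : ℂ) + expB b p j = 1 + sOf (p j).2 / (Real.log b : ℂ) from rfl, zetaW_eq_zetaWN hW hu2,
    lcmPairKernel_eq, zetaRatioW]
  have h1 := (hN j).1
  have h2 := (hN j).2
  have hφ' : (Nat.totient W : ℂ) ≠ 0 :=
    Nat.cast_ne_zero.2 (Nat.totient_pos.2 (Nat.pos_of_ne_zero hW)).ne'
  push_cast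
  field_simp

/-- If `‖𝒩_W(s/L) − 1‖, ‖𝒩_W(s'/L) − 1‖, ‖𝒩_W((s+s')/L) − 1‖ ≤ δ ≤ 1/4` then the 𝒩's are non-zero and
`‖R − 1‖ ≤ 8δ`. [cite: Maynard2016LargeGaps, §6 display (6.18)] -/
theorem norm_zetaRatioW_sub_one_le {W : ℕ} {L : ℝ} {q : ℝ × ℝ} {δ : ℝ} (hδ : δ ≤ 1 / 4)
    (h₁ : ‖zetaWN W (sOf q.1 / (L : ℂ)) - 1‖ ≤ δ) (h₂ : ‖zetaWN W (sOf q.2 / (L : ℂ)) - 1‖ ≤ δ)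
    (h₃ : ‖zetaWN W ((sOf q.1 + sOf q.2) / (L : ℂ)) - 1‖ ≤ δ) :
    (zetaWN W (sOf q.1 / (L : ℂ)) ≠ 0 ∧ zetaWN W (sOf q.2 / (L : ℂ)) ≠ 0) ∧
      ‖zetaRatioW W L q - 1‖ ≤ 8 * δ := by
  have hne : ∀ {u : ℂ}, ‖u - 1‖ ≤ δ → u ≠ 0 := fun {u} hu h0 => by
    rw [h0, zero_sub, norm_neg, norm_one] at hu; linarith
  exact ⟨⟨hne h₁, hne h₂⟩, norm_div_mul_sub_one_le hδ h₁ h₂ h₃⟩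

end LcmEuler

namespace Maynard2016

open LcmEuler

variable {ι : Type*} [Fintype ι]

omit [Fintype ι] in
/-- In the cube `InCube R p` with `1 ≤ R` and at a scale `L ≥ L₀ > 0`: the arguments `s(ξ_j)/L`,
`s(ξ'_j)/L`, `(s(ξ_j)+s(ξ'_j))/L` all have norm `≤ (2+4π) R/L₀`. [cite: Maynard2016LargeGaps, §6 display (6.17)] -/
theorem norm_sOf_div_le_of_inCube {R L L₀ : ℝ} (hR : 1 ≤ R) (hL₀ : 0 < L₀) (hL : L₀ ≤ L)
    {p : ι → ℝ × ℝ} (hp : InCube R p) (j : ι) :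
    ‖sOf (p j).1 / (L : ℂ)‖ ≤ (2 + 4 * π) * R / L₀ ∧ ‖sOf (p j).2 / (L : ℂ)‖ ≤ (2 + 4 * π) * R / L₀ ∧
      ‖(sOf (p j).1 + sOf (p j).2) / (L : ℂ)‖ ≤ (2 + 4 * π) * R / L₀ := by
  obtain ⟨h1, h2, h3⟩ := norm_sOf_le_of_inCube hR hp j
  have hLpos : 0 < L := lt_of_lt_of_le hL₀ hL
  have hnL : ‖(L : ℂ)‖ = L := by rw [Complex.norm_real, Real.norm_eq_abs, abs_of_pos hLpos]
  have hc : 0 ≤ (2 + 4 * π) * R := by nlinarith [Real.pi_pos]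
  have key : ∀ {u : ℂ}, ‖u‖ ≤ (2 + 4 * π) * R → ‖u / (L : ℂ)‖ ≤ (2 + 4 * π) * R / L₀ := by
    intro u hu
    rw [norm_div, hnL]
    calc ‖u‖ / L ≤ (2 + 4 * π) * R / L := div_le_div_of_nonneg_right hu hLpos.le
      _ ≤ (2 + 4 * π) * R / L₀ := div_le_div_of_nonneg_left hc hL₀ hL
  exact ⟨key h1, key h2, key h3⟩

/-- **`∏_j R_j = 1 + o(1)` on the cube, at every scale `b` with `log y ≤ log b`** ((6.18)): for
`ε < 1`, `η > 0`, eventually in `x : ℕ`, for every real `b` with `log y_{ε}(x) ≤ log b` and every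
`p` in the cube `InCube √(log x)`: all `𝒩_{P_w}(s(ξ_j)/log b)`, `𝒩_{P_w}(s(ξ'_j)/log b)` are
non-zero and `‖∏_j R_{P_w}(log b; ξ_j, ξ'_j) − 1‖ ≤ η`. [cite: Maynard2016LargeGaps, §6 display (6.18)] -/
theorem eventually_norm_prod_zetaRatioW_sub_one_le {ε : ℝ} (hε : ε < 1) {η : ℝ} (hη : 0 < η) :
    ∀ᶠ x : ℕ in atTop, ∀ b : ℝ, Real.log (y ε x) ≤ Real.log b →
      ∀ p : ι → ℝ × ℝ, InCube (Real.sqrt (Real.log x)) p →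
        (∀ j, zetaWN (Pw x) (sOf (p j).1 / (Real.log b : ℂ)) ≠ 0 ∧
            zetaWN (Pw x) (sOf (p j).2 / (Real.log b : ℂ)) ≠ 0) ∧
          ‖∏ j, zetaRatioW (Pw x) (Real.log b) (p j) - 1‖ ≤ η := by
  -- choose `δ` with `8 δ k ≤ log(1+η)` and `δ ≤ 1/4`
  set k : ℕ := Fintype.card ι with hk
  set δ : ℝ := min (1 / 4) (Real.log (1 + η) / (8 * (k + 1))) with hδ
  have hlog : 0 < Real.log (1 + η) := Real.log_pos (by linarith)
  have hδpos : 0 < δ := lt_min (by norm_num) (by positivity)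
  have hδ4 : δ ≤ 1 / 4 := min_le_left _ _
  have hδk : 8 * δ * k ≤ Real.log (1 + η) := by
    have h1 : δ ≤ Real.log (1 + η) / (8 * (k + 1)) := min_le_right _ _
    rw [le_div_iff₀ (by positivity)] at h1
    nlinarith [hδpos.le, (Nat.cast_nonneg k : (0 : ℝ) ≤ k)]
  filter_upwards [eventually_norm_zetaWN_Pw_sub_one_le hε hδpos (2 + 4 * π), eventually_iteratedLogs]
    with x hx hlogs b hb p hp
  obtain ⟨hL, hL₂, hL₃, -, -, -, -⟩ := hlogs
  have hL0 : 0 < Real.log x := by linarith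
  have hR : 1 ≤ Real.sqrt (Real.log x) := by
    rw [show (1 : ℝ) = Real.sqrt 1 from Real.sqrt_one.symm]
    exact Real.sqrt_le_sqrt (by linarith)
  have hly : 0 < Real.log (y ε x) := by
    rw [log_y]; exact mul_pos (by linarith) (div_pos (mul_pos hL0 (by linarith)) (by linarith))
  -- every argument `u` in sight: `u ≠ 0`, `‖u‖ ≤ (2+4π) √(log x)/log y`
  have hbnd : ∀ j, ‖zetaWN (Pw x) (sOf (p j).1 / (Real.log b : ℂ)) - 1‖ ≤ δ ∧
      ‖zetaWN (Pw x) (sOf (p j).2 / (Real.log b : ℂ)) - 1‖ ≤ δ ∧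
      ‖zetaWN (Pw x) ((sOf (p j).1 + sOf (p j).2) / (Real.log b : ℂ)) - 1‖ ≤ δ := by
    intro j
    obtain ⟨h1, h2, h3⟩ := norm_sOf_div_le_of_inCube hR hly hb hp j
    have hLb : (Real.log b : ℂ) ≠ 0 := by exact_mod_cast (lt_of_lt_of_le hly hb).ne'
    exact ⟨hx _ (div_ne_zero (sOf_ne_zero _) hLb) h1, hx _ (div_ne_zero (sOf_ne_zero _) hLb) h2,
      hx _ (div_ne_zero (sOf_add_sOf_ne_zero (p j).1 (p j).2) hLb) h3⟩
  have hR : ∀ j, (zetaWN (Pw x) (sOf (p j).1 / (Real.log b : ℂ)) ≠ 0 ∧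
      zetaWN (Pw x) (sOf (p j).2 / (Real.log b : ℂ)) ≠ 0) ∧
      ‖zetaRatioW (Pw x) (Real.log b) (p j) - 1‖ ≤ 8 * δ := fun j =>
    norm_zetaRatioW_sub_one_le hδ4 (hbnd j).1 (hbnd j).2.1 (hbnd j).2.2
  refine ⟨fun j => (hR j).1, ?_⟩
  refine (norm_prod_sub_one_le_exp _ _).trans ?_
  have hsum : ∑ j, ‖zetaRatioW (Pw x) (Real.log b) (p j) - 1‖ ≤ Real.log (1 + η) := by
    calc ∑ j, ‖zetaRatioW (Pw x) (Real.log b) (p j) - 1‖ ≤ ∑ _j : ι, 8 * δ :=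
          Finset.sum_le_sum fun j _ => (hR j).2
      _ = 8 * δ * k := by rw [Finset.sum_const, Finset.card_univ, ← hk, nsmul_eq_mul]; ring
      _ ≤ Real.log (1 + η) := hδk
  calc Real.exp (∑ j, ‖zetaRatioW (Pw x) (Real.log b) (p j) - 1‖) - 1
      ≤ Real.exp (Real.log (1 + η)) - 1 := by gcongr
    _ = η := by rw [Real.exp_log (by linarith)]; ring

end Maynard2016

end Literature.NumberTheory.Sieve

end
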